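import Literature.NumberTheory.LFunctions.MertensSecondLogPower
import Literature.NumberTheory.LFunctions.MertensTail
import Mathlib.NumberTheory.AbelSummation
import HarnessLib

/-!
# The prime sums `∑_{p ≤ x} cos(t log p)/p`

Topic `Literature/NumberTheory/LFunctions`.  Everything in this file is PROVED (no named facts).

For real `t` and `x ≥ 2` put `G(x,t) = ∑_{p ≤ x} cos(t log p)/p`, the real part of the prime sum
`∑_{p ≤ x} p^{-1-it}`, which governs the size of the truncated Euler product
`ζ_x(1+it) = ∏_{p ≤ x} (1 - p^{-1-it})^{-1}` (`log |ζ_x(1+it)| = G(x,t) + O(1)`).  From Mertens' second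
theorem with a log-power remainder (`Mertens.abs_sum_primesLE_inv_sub_loglog_le`, proved in the tree
from the prime number theorem with the de la Vallée Poussin error term) and Abel summation we prove
the three classical estimates (Montgomery–Vaughan, *Multiplicative Number Theory I*, §6.2 / the
method of proof of Lemma 2.3 of Granville–Soundararajan 2003):

* `abs_integral_cos_log_div_le` — `|∫_P^Q cos(t log v) dv/(v log v)| ≤ 3/(|t| log P)` (`t ≠ 0`,
  `1 < P ≤ Q`; integration by parts);
* `exists_abs_sum_prime_cos_sub_integral_le` — prime sum versus integral on `(P, Q]`:
  `|∑_{P < p ≤ Q} cos(t log p)/p - ∫_P^Q cos(t log v) dv/(v log v)| ≤ 2K/log¹¹P + |t| K/(10 log¹⁰ P)`;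
* `exists_G_ge` — `G(x,δ) ≥ log(1/δ) - C` for `0 < δ ≤ 1 ≤ δ log x`;
* `exists_G_le_small` — `G(x,t) ≤ log(1/t) + C` for `0 < t ≤ 1`, `x ≥ 2`;
* `exists_G_le_large` — `G(x,t) ≤ (log t)/10 + C` for `t ≥ 1`, `x ≥ 2`.

(The constant `1/10` is any fixed positive number; absolute constants are existential.)  These are
the inputs of the refutation of the edge case of Theorem 4 of Granville–Soundararajan 2003
(`GranvilleSoundararajan2003Theorem4EdgeRefutation.lean`).

## References

* H. L. Montgomery, R. C. Vaughan, *Multiplicative Number Theory I. Classical Theory*, CUP 2007,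
  Thm 2.7 (d), §6.2. [cite: MontgomeryVaughan2007, §6.2]
* A. Granville, K. Soundararajan, *Decay of mean values of multiplicative functions*, Canad. J. Math.
  55 (2003), proof of Lemma 2.3 (arXiv math/9911246, p. 5). [cite: GranvilleSoundararajan2003, Lemma 2.3]
-/

noncomputable section

open Finset Real MeasureTheory Set Filter

namespace Literature.NumberTheory.LFunctions.PrimeCosineSum

/-- `G(x,t) = ∑_{p ≤ x} cos(t log p)/p`. [folklore] -/
def G (x t : ℝ) : ℝ := ∑ p ∈ Nat.primesLE ⌊x⌋₊, Real.cos (t * Real.log p) / p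

/-! ### The oscillatory integral `∫ cos(t log v) dv/(v log v)` -/

/-- The antiderivative used for `∫ cos(t log v)/(v log v)`: `h(v) = sin(t log v)/(t log v)` has
`h'(v) = cos(t log v)/(v log v) - sin(t log v)/(t v log² v)` for `v > 1`, `t ≠ 0`. [folklore] -/
theorem hasDerivAt_sin_log_div {t v : ℝ} (ht : t ≠ 0) (hv : 1 < v) :
    HasDerivAt (fun v : ℝ => Real.sin (t * Real.log v) / (t * Real.log v))
      (Real.cos (t * Real.log v) / (v * Real.log v)
        - Real.sin (t * Real.log v) / (t * v * Real.log v ^ 2)) v := by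
  have hv0 : v ≠ 0 := by linarith
  have hl : Real.log v ≠ 0 := (Real.log_pos hv).ne'
  have hlog : HasDerivAt (fun v : ℝ => t * Real.log v) (t * v⁻¹) v :=
    (Real.hasDerivAt_log hv0).const_mul t
  have hsin : HasDerivAt (fun v : ℝ => Real.sin (t * Real.log v))
      (Real.cos (t * Real.log v) * (t * v⁻¹)) v := (Real.hasDerivAt_sin _).comp v hlog
  have hdiv : HasDerivAt (fun v : ℝ => Real.sin (t * Real.log v) / (t * Real.log v))
      ((Real.cos (t * Real.log v) * (t * v⁻¹) * (t * Real.log v)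
        - Real.sin (t * Real.log v) * (t * v⁻¹)) / (t * Real.log v) ^ 2) v :=
    hsin.div hlog (mul_ne_zero ht hl)
  refine hdiv.congr_deriv ?_
  field_simp

/-- `|∫_P^Q cos(t log v) dv/(v log v)| ≤ 3/(|t| log P)` for `t ≠ 0`, `1 < P ≤ Q` (integrate by parts
once: boundary terms `≤ 1/(|t| log P)` each, and `∫_P^∞ dv/(|t| v log² v) = 1/(|t| log P)`).
[cite: GranvilleSoundararajan2003, proof of Lemma 2.3] -/
theorem abs_integral_cos_log_div_le {t P Q : ℝ} (ht : t ≠ 0) (hP : 1 < P) (hPQ : P ≤ Q) :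
    |∫ v in P..Q, Real.cos (t * Real.log v) / (v * Real.log v)| ≤ 3 / (|t| * Real.log P) := by
  have hlP : 0 < Real.log P := Real.log_pos hP
  have ht0 : 0 < |t| := abs_pos.mpr ht
  have hmem : ∀ v ∈ Set.Icc P Q, 1 < v := fun v hv => hP.trans_le hv.1
  -- the two integrands
  set a : ℝ → ℝ := fun v => Real.cos (t * Real.log v) / (v * Real.log v) with ha
  set b : ℝ → ℝ := fun v => Real.sin (t * Real.log v) / (t * v * Real.log v ^ 2) with hb
  set h : ℝ → ℝ := fun v => Real.sin (t * Real.log v) / (t * Real.log v) with hh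
  have hne0 : ∀ v ∈ Set.Icc P Q, v ≠ 0 := fun v hv => by linarith [hmem v hv]
  have hlne : ∀ v ∈ Set.Icc P Q, Real.log v ≠ 0 := fun v hv => (Real.log_pos (hmem v hv)).ne'
  have hcont_log : ContinuousOn (fun v : ℝ => Real.log v) (Set.Icc P Q) :=
    Real.continuousOn_log.mono fun v hv => hne0 v hv
  have hcont_tl : ContinuousOn (fun v : ℝ => t * Real.log v) (Set.Icc P Q) :=
    continuousOn_const.mul hcont_log
  have ha_cont : ContinuousOn a (Set.Icc P Q) := by
    refine ContinuousOn.div (Real.continuous_cos.comp_continuousOn hcont_tl)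
      (continuousOn_id.mul hcont_log) fun v hv => mul_ne_zero (hne0 v hv) (hlne v hv)
  have hb_cont : ContinuousOn b (Set.Icc P Q) := by
    refine ContinuousOn.div (Real.continuous_sin.comp_continuousOn hcont_tl)
      ((continuousOn_const.mul continuousOn_id).mul (hcont_log.pow 2)) fun v hv => ?_
    exact mul_ne_zero (mul_ne_zero ht (hne0 v hv)) (pow_ne_zero _ (hlne v hv))
  have ha_int : IntervalIntegrable a volume P Q := (ha_cont.mono (by rw [Set.uIcc_of_le hPQ])).intervalIntegrable
  have hb_int : IntervalIntegrable b volume P Q := (hb_cont.mono (by rw [Set.uIcc_of_le hPQ])).intervalIntegrable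
  -- FTC for `h`
  have hFTC : ∫ v in P..Q, (a v - b v) = h Q - h P := by
    refine intervalIntegral.integral_eq_sub_of_hasDerivAt (fun v hv => ?_) (ha_int.sub hb_int)
    rw [Set.uIcc_of_le hPQ] at hv
    exact hasDerivAt_sin_log_div ht (hmem v hv)
  have hsplit : ∫ v in P..Q, a v = (h Q - h P) + ∫ v in P..Q, b v := by
    rw [← hFTC, intervalIntegral.integral_sub ha_int hb_int]; ring
  -- bounds for the boundary terms
  have hbound_h : ∀ v, P ≤ v → |h v| ≤ 1 / (|t| * Real.log P) := by
    intro v hv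
    have hlv : 0 < Real.log v := Real.log_pos (hP.trans_le hv)
    have hlPv : Real.log P ≤ Real.log v := Real.log_le_log (by linarith) hv
    simp only [hh]
    rw [abs_div, abs_mul, abs_of_pos hlv]
    calc |Real.sin (t * Real.log v)| / (|t| * Real.log v) ≤ 1 / (|t| * Real.log v) :=
          div_le_div_of_nonneg_right (Real.abs_sin_le_one _) (by positivity)
      _ ≤ 1 / (|t| * Real.log P) :=
          div_le_div_of_nonneg_left zero_le_one (by positivity) (by gcongr)
  -- bound for `∫ b`
  have hbound_b : |∫ v in P..Q, b v| ≤ 1 / (|t| * Real.log P) := by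
    rw [intervalIntegral.integral_of_le hPQ]
    have hwint : IntegrableOn (fun v : ℝ => v⁻¹ / Real.log v ^ (0 + 2)) (Set.Ioi P) :=
      Mertens.integrableOn_inv_div_log_pow hP 0
    have hmaj : ∀ᵐ v ∂(volume.restrict (Set.Ioc P Q)), ‖b v‖ ≤ |t|⁻¹ * (v⁻¹ / Real.log v ^ (0 + 2)) := by
      rw [ae_restrict_iff' measurableSet_Ioc]
      refine Eventually.of_forall fun v hv => ?_
      have hv1 : 1 < v := hP.trans hv.1
      have hv0 : 0 < v := by linarith
      have hlv : 0 < Real.log v := Real.log_pos hv1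
      simp only [hb, Real.norm_eq_abs, Nat.zero_add]
      rw [abs_div, abs_mul, abs_mul, abs_of_pos hv0, abs_of_pos (pow_pos hlv 2)]
      calc |Real.sin (t * Real.log v)| / (|t| * v * Real.log v ^ 2) ≤ 1 / (|t| * v * Real.log v ^ 2) :=
            div_le_div_of_nonneg_right (Real.abs_sin_le_one _) (by positivity)
        _ = |t|⁻¹ * (v⁻¹ / Real.log v ^ 2) := by field_simp
    calc |∫ v in Set.Ioc P Q, b v| = ‖∫ v in Set.Ioc P Q, b v‖ := rfl
      _ ≤ ∫ v in Set.Ioc P Q, |t|⁻¹ * (v⁻¹ / Real.log v ^ (0 + 2)) :=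
          norm_integral_le_of_norm_le ((hwint.mono_set Set.Ioc_subset_Ioi_self).const_mul _) hmaj
      _ ≤ ∫ v in Set.Ioi P, |t|⁻¹ * (v⁻¹ / Real.log v ^ (0 + 2)) := by
          refine setIntegral_mono_set (hwint.const_mul _) ?_ Set.Ioc_subset_Ioi_self.eventuallyLE
          rw [EventuallyLE, ae_restrict_iff' measurableSet_Ioi]
          refine Eventually.of_forall fun v hv => ?_
          have hv0 : 0 < v := by linarith [hP.trans hv]
          have hlv : 0 < Real.log v := Real.log_pos (hP.trans hv)
          simp only [Pi.zero_apply]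
          positivity
      _ = |t|⁻¹ * (((0 : ℕ) : ℝ) + 1)⁻¹ * (Real.log P ^ (0 + 1))⁻¹ := by
          rw [integral_const_mul, Mertens.integral_Ioi_inv_div_log_pow hP 0, mul_inv, mul_assoc]
      _ = 1 / (|t| * Real.log P) := by simp; ring
  -- assemble
  rw [hsplit]
  have h1 := hbound_h Q hPQ
  have h2 := hbound_h P le_rfl
  have e3 : (3 : ℝ) / (|t| * Real.log P) = 1 / (|t| * Real.log P) + 1 / (|t| * Real.log P) + 1 / (|t| * Real.log P) := by ring
  rw [e3]
  calc |h Q - h P + ∫ v in P..Q, b v| ≤ |h Q - h P| + |∫ v in P..Q, b v| := abs_add_le _ _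
    _ ≤ (|h Q| + |h P|) + |∫ v in P..Q, b v| := by gcongr; exact abs_sub _ _
    _ ≤ (1 / (|t| * Real.log P) + 1 / (|t| * Real.log P)) + 1 / (|t| * Real.log P) := by gcongr


/-! ### Prime sums against `cos(t log v)`: Abel summation with Mertens' remainder -/

/-- `∑_{k ≤ m} [k prime]/k = ∑_{p ≤ m} 1/p`. [folklore] -/
theorem sum_Icc_ite_prime_inv (m : ℕ) :
    ∑ k ∈ Icc 0 m, (if k.Prime then (k : ℝ)⁻¹ else 0) = ∑ p ∈ Nat.primesLE m, (p : ℝ)⁻¹ := by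
  rw [Nat.primesLE_eq_filter_range, Finset.sum_filter, Nat.range_succ_eq_Icc_zero]

/-- **Prime sums against `cos(t log v)`.**  With `K` the constant of Mertens' second theorem with
remainder `K/log¹¹` (`Mertens.abs_sum_primesLE_inv_sub_loglog_le 11`): for `2 ≤ P ≤ Q` and real `t`,
`|∑_{P < p ≤ Q} cos(t log p)/p - ∫_P^Q cos(t log v) dv/(v log v)| ≤ 2K/log¹¹ P + |t| K/(10 log¹⁰ P)`
(Abel summation: `∑_{P<p≤Q} cos(t log p)/p = [cos(t log v) M(v)]_P^Q + t∫_P^Q sin(t log v) M(v) dv/v`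
with `M(v) = ∑_{p ≤ v} 1/p = log log v + B₁ + O(1/log¹¹ v)`, and the smooth part integrates back by parts
to `∫_P^Q cos(t log v) dv/(v log v)`). [cite: MontgomeryVaughan2007, Thm 2.7 (d) and §6.2] -/
theorem exists_abs_sum_prime_cos_sub_integral_le :
    ∃ K : ℝ, 0 ≤ K ∧ ∀ t P Q : ℝ, 2 ≤ P → P ≤ Q →
      |∑ p ∈ (Finset.Ioc ⌊P⌋₊ ⌊Q⌋₊).filter Nat.Prime, Real.cos (t * Real.log p) / p
          - ∫ v in P..Q, Real.cos (t * Real.log v) / (v * Real.log v)|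
        ≤ 2 * K / Real.log P ^ 11 + |t| * K / (10 * Real.log P ^ 10) := by
  obtain ⟨K, hK⟩ := Mertens.abs_sum_primesLE_inv_sub_loglog_le 11
  have hl2 : 0 < Real.log 2 := Real.log_pos one_lt_two
  have hK0 : 0 ≤ K := by
    have h := hK 2 le_rfl
    have h' : 0 ≤ K / Real.log 2 ^ 11 := (abs_nonneg _).trans h
    by_contra hneg
    have : K / Real.log 2 ^ 11 < 0 := div_neg_of_neg_of_pos (not_le.mp hneg) (pow_pos hl2 11)
    linarith
  refine ⟨K, hK0, fun t P Q hP hPQ => ?_⟩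
  have hP0 : (0 : ℝ) ≤ P := by linarith
  have hP1 : (1 : ℝ) < P := by linarith
  have hlP : 0 < Real.log P := Real.log_pos hP1
  have hmem1 : ∀ v ∈ Set.Icc P Q, 1 < v := fun v hv => hP1.trans_le hv.1
  have hne0 : ∀ v ∈ Set.Icc P Q, v ≠ 0 := fun v hv => by linarith [hmem1 v hv]
  have hlne : ∀ v ∈ Set.Icc P Q, Real.log v ≠ 0 := fun v hv => (Real.log_pos (hmem1 v hv)).ne'
  -- the cast of characters
  set c : ℕ → ℝ := fun k => if k.Prime then (k : ℝ)⁻¹ else 0 with hc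
  set f : ℝ → ℝ := fun v => Real.cos (t * Real.log v) with hf
  set g : ℝ → ℝ := fun v => -(Real.sin (t * Real.log v) * (t * v⁻¹)) with hg
  set S : ℝ → ℝ := fun v => ∑ k ∈ Icc 0 ⌊v⌋₊, c k with hSdef
  set m : ℝ → ℝ := fun v => Real.log (Real.log v) + Mertens.meisselMertens with hm
  set E : ℝ → ℝ := fun v => S v - m v with hEdef
  set a : ℝ → ℝ := fun v => Real.cos (t * Real.log v) / (v * Real.log v) with ha
  have hS : ∀ v, S v = ∑ p ∈ Nat.primesLE ⌊v⌋₊, (p : ℝ)⁻¹ := fun v => sum_Icc_ite_prime_inv _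
  have hE : ∀ v, 2 ≤ v → |E v| ≤ K / Real.log v ^ 11 := fun v hv => by
    simp only [hEdef, hS, hm]; exact hK v hv
  -- derivatives
  have hderiv : ∀ v : ℝ, 0 < v → HasDerivAt f (g v) v := by
    intro v hv
    have h := ((Real.hasDerivAt_log hv.ne').const_mul t).cos
    simpa [hf, hg] using h
  have hf_diff : ∀ v ∈ Set.Icc P Q, DifferentiableAt ℝ f v := fun v hv =>
    (hderiv v (by linarith [hmem1 v hv])).differentiableAt
  have hderiv_eq : Set.EqOn g (deriv f) (Set.Icc P Q) := fun v hv =>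
    ((hderiv v (by linarith [hmem1 v hv])).deriv).symm
  have hcont_log : ContinuousOn (fun v : ℝ => Real.log v) (Set.Icc P Q) :=
    Real.continuousOn_log.mono fun v hv => hne0 v hv
  have hcont_tl : ContinuousOn (fun v : ℝ => t * Real.log v) (Set.Icc P Q) :=
    continuousOn_const.mul hcont_log
  have hcont_inv : ContinuousOn (fun v : ℝ => v⁻¹) (Set.Icc P Q) :=
    continuousOn_inv₀.mono fun v hv => Set.mem_compl_singleton_iff.mpr (hne0 v hv)
  have hgcont : ContinuousOn g (Set.Icc P Q) :=
    ((Real.continuous_sin.comp_continuousOn hcont_tl).mul (continuousOn_const.mul hcont_inv)).neg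
  have hfcont : ContinuousOn f (Set.Icc P Q) := Real.continuous_cos.comp_continuousOn hcont_tl
  have hmcont : ContinuousOn m (Set.Icc P Q) :=
    (hcont_log.log fun v hv => hlne v hv).add continuousOn_const
  have hacont : ContinuousOn a (Set.Icc P Q) :=
    ContinuousOn.div (Real.continuous_cos.comp_continuousOn hcont_tl)
      (continuousOn_id.mul hcont_log) fun v hv => mul_ne_zero (hne0 v hv) (hlne v hv)
  have hg_int : IntegrableOn g (Set.Icc P Q) := hgcont.integrableOn_Icc
  have hf_int : IntegrableOn (deriv f) (Set.Icc P Q) := hg_int.congr_fun hderiv_eq measurableSet_Icc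
  -- Abel summation
  have habel := sum_mul_eq_sub_sub_integral_mul c hP0 hPQ hf_diff hf_int
  have hlhs : ∑ k ∈ Finset.Ioc ⌊P⌋₊ ⌊Q⌋₊, f k * c k =
      ∑ p ∈ (Finset.Ioc ⌊P⌋₊ ⌊Q⌋₊).filter Nat.Prime, Real.cos (t * Real.log p) / p := by
    rw [Finset.sum_filter]
    refine Finset.sum_congr rfl fun k _ => ?_
    simp only [hc, hf]
    split_ifs <;> simp [div_eq_mul_inv]
  have hint_deriv : ∫ v in Set.Ioc P Q, deriv f v * S v = ∫ v in Set.Ioc P Q, g v * S v := by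
    refine setIntegral_congr_fun measurableSet_Ioc fun v hv => ?_
    rw [hderiv_eq (Set.Ioc_subset_Icc_self hv)]
  -- integrability on `Ioc P Q`
  have hgS_int : IntegrableOn (fun v => g v * S v) (Set.Ioc P Q) :=
    (integrableOn_mul_sum_Icc c hP0 hg_int).mono_set Set.Ioc_subset_Icc_self
  have hgm_int : IntegrableOn (fun v => g v * m v) (Set.Ioc P Q) :=
    (hgcont.mul hmcont).integrableOn_Icc.mono_set Set.Ioc_subset_Icc_self
  have hgE_int : IntegrableOn (fun v => g v * E v) (Set.Ioc P Q) := by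
    refine (hgS_int.sub hgm_int).congr_fun (fun v _ => ?_) measurableSet_Ioc
    simp only [hEdef, Pi.sub_apply]; ring
  have hsplit : ∫ v in Set.Ioc P Q, g v * S v =
      (∫ v in Set.Ioc P Q, g v * m v) + ∫ v in Set.Ioc P Q, g v * E v := by
    rw [← integral_add hgm_int hgE_int]
    refine setIntegral_congr_fun measurableSet_Ioc fun v _ => ?_
    simp only [hEdef]; ring
  -- the smooth part integrates back by parts: `∫ g m = [f m] - ∫ a`
  have ha_int : IntervalIntegrable a volume P Q :=
    (hacont.mono (by rw [Set.uIcc_of_le hPQ])).intervalIntegrable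
  have hgm_int' : IntervalIntegrable (fun v => g v * m v) volume P Q :=
    ((hgcont.mul hmcont).mono (by rw [Set.uIcc_of_le hPQ])).intervalIntegrable
  have hFTC : ∫ v in P..Q, (g v * m v + a v) = f Q * m Q - f P * m P := by
    refine intervalIntegral.integral_eq_sub_of_hasDerivAt (f := fun v => f v * m v)
      (fun v hv => ?_) (hgm_int'.add ha_int)
    rw [Set.uIcc_of_le hPQ] at hv
    have hv1 : 1 < v := hmem1 v hv
    have hv0 : 0 < v := by linarith
    have hl : Real.log v ≠ 0 := (Real.log_pos hv1).ne'
    have hmd : HasDerivAt m (v⁻¹ / Real.log v) v := by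
      have h := ((Real.hasDerivAt_log hv0.ne').log hl).add_const Mertens.meisselMertens
      simpa [hm] using h
    have h := (hderiv v hv0).mul hmd
    refine h.congr_deriv ?_
    simp only [ha, hf]
    field_simp
  have hgm_eq : ∫ v in Set.Ioc P Q, g v * m v = f Q * m Q - f P * m P - ∫ v in P..Q, a v := by
    rw [← intervalIntegral.integral_of_le hPQ, ← hFTC, intervalIntegral.integral_add hgm_int' ha_int]
    ring
  -- the identity `∑ - ∫ a = f Q E Q - f P E P - ∫ g E`
  have hident : ∑ p ∈ (Finset.Ioc ⌊P⌋₊ ⌊Q⌋₊).filter Nat.Prime, Real.cos (t * Real.log p) / p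
      - ∫ v in P..Q, a v = f Q * E Q - f P * E P - ∫ v in Set.Ioc P Q, g v * E v := by
    rw [← hlhs, habel, hint_deriv, hsplit, hgm_eq]
    simp only [hEdef]
    ring
  -- bounds
  have hfle : ∀ v, |f v| ≤ 1 := fun v => Real.abs_cos_le_one _
  have hEQ : |f Q * E Q| ≤ K / Real.log P ^ 11 := by
    rw [abs_mul]
    have hQ2 : 2 ≤ Q := hP.trans hPQ
    calc |f Q| * |E Q| ≤ 1 * (K / Real.log Q ^ 11) :=
          mul_le_mul (hfle Q) (hE Q hQ2) (abs_nonneg _) zero_le_one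
      _ ≤ K / Real.log P ^ 11 := by
          rw [one_mul]
          exact div_le_div_of_nonneg_left hK0 (pow_pos hlP 11)
            (pow_le_pow_left₀ hlP.le (Real.log_le_log (by linarith) hPQ) 11)
  have hEP : |f P * E P| ≤ K / Real.log P ^ 11 := by
    rw [abs_mul]
    calc |f P| * |E P| ≤ 1 * (K / Real.log P ^ 11) :=
          mul_le_mul (hfle P) (hE P hP) (abs_nonneg _) zero_le_one
      _ = K / Real.log P ^ 11 := one_mul _
  have hgE : |∫ v in Set.Ioc P Q, g v * E v| ≤ |t| * K / (10 * Real.log P ^ 10) := by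
    have hwint : IntegrableOn (fun v : ℝ => v⁻¹ / Real.log v ^ (9 + 2)) (Set.Ioi P) :=
      Mertens.integrableOn_inv_div_log_pow hP1 9
    have hmaj : ∀ᵐ v ∂(volume.restrict (Set.Ioc P Q)),
        ‖g v * E v‖ ≤ |t| * K * (v⁻¹ / Real.log v ^ (9 + 2)) := by
      rw [ae_restrict_iff' measurableSet_Ioc]
      refine Eventually.of_forall fun v hv => ?_
      have hv2 : 2 ≤ v := hP.trans hv.1.le
      have hv0 : 0 < v := by linarith
      have hlv : 0 < Real.log v := Real.log_pos (by linarith)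
      rw [Real.norm_eq_abs, abs_mul]
      have hg1 : |g v| ≤ |t| * v⁻¹ := by
        simp only [hg, abs_neg, abs_mul, abs_inv, abs_of_pos hv0]
        calc |Real.sin (t * Real.log v)| * (|t| * v⁻¹) ≤ 1 * (|t| * v⁻¹) :=
              mul_le_mul_of_nonneg_right (Real.abs_sin_le_one _) (by positivity)
          _ = |t| * v⁻¹ := one_mul _
      calc |g v| * |E v| ≤ (|t| * v⁻¹) * (K / Real.log v ^ 11) :=
            mul_le_mul hg1 (hE v hv2) (abs_nonneg _) (by positivity)
        _ = |t| * K * (v⁻¹ / Real.log v ^ (9 + 2)) := by ring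
    calc |∫ v in Set.Ioc P Q, g v * E v| = ‖∫ v in Set.Ioc P Q, g v * E v‖ := rfl
      _ ≤ ∫ v in Set.Ioc P Q, |t| * K * (v⁻¹ / Real.log v ^ (9 + 2)) :=
          norm_integral_le_of_norm_le ((hwint.mono_set Set.Ioc_subset_Ioi_self).const_mul _) hmaj
      _ ≤ ∫ v in Set.Ioi P, |t| * K * (v⁻¹ / Real.log v ^ (9 + 2)) := by
          refine setIntegral_mono_set (hwint.const_mul _) ?_ Set.Ioc_subset_Ioi_self.eventuallyLE
          rw [EventuallyLE, ae_restrict_iff' measurableSet_Ioi]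
          refine Eventually.of_forall fun v hv => ?_
          have hv0 : 0 < v := by linarith [hP1.trans hv]
          have hlv : 0 < Real.log v := Real.log_pos (hP1.trans hv)
          simp only [Pi.zero_apply]
          positivity
      _ = |t| * K * ((((9 : ℕ) : ℝ) + 1) * Real.log P ^ (9 + 1))⁻¹ := by
          rw [integral_const_mul, Mertens.integral_Ioi_inv_div_log_pow hP1 9]
      _ = |t| * K / (10 * Real.log P ^ 10) := by norm_num [div_eq_mul_inv]
  -- conclusion
  rw [hident]
  have e2 : 2 * K / Real.log P ^ 11 = K / Real.log P ^ 11 + K / Real.log P ^ 11 := by ring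
  rw [e2]
  calc |f Q * E Q - f P * E P - ∫ v in Set.Ioc P Q, g v * E v|
      ≤ |f Q * E Q - f P * E P| + |∫ v in Set.Ioc P Q, g v * E v| := abs_sub _ _
    _ ≤ (|f Q * E Q| + |f P * E P|) + |∫ v in Set.Ioc P Q, g v * E v| := by
        gcongr; exact abs_sub _ _
    _ ≤ (K / Real.log P ^ 11 + K / Real.log P ^ 11) + |t| * K / (10 * Real.log P ^ 10) := by
        gcongr


/-! ### Splitting `G` and the three size estimates -/

/-- `G(x,t) = G(A,t) + ∑_{A < p ≤ x} cos(t log p)/p` for `0 ≤ A ≤ x`. [folklore] -/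
theorem G_split {A x : ℝ} (hAx : A ≤ x) (t : ℝ) :
    G x t = G A t + ∑ p ∈ (Finset.Ioc ⌊A⌋₊ ⌊x⌋₊).filter Nat.Prime, Real.cos (t * Real.log p) / p := by
  unfold G
  have hfl : ⌊A⌋₊ ≤ ⌊x⌋₊ := Nat.floor_le_floor hAx
  have hunion : Finset.Icc 0 ⌊x⌋₊ = Finset.Icc 0 ⌊A⌋₊ ∪ Finset.Ioc ⌊A⌋₊ ⌊x⌋₊ := by
    ext n
    simp only [Finset.mem_union, Finset.mem_Icc, Finset.mem_Ioc]
    omega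
  have hdisj : Disjoint (Finset.Icc 0 ⌊A⌋₊) (Finset.Ioc ⌊A⌋₊ ⌊x⌋₊) := by
    rw [Finset.disjoint_left]
    intro n hn hn'
    simp only [Finset.mem_Icc, Finset.mem_Ioc] at hn hn'
    omega
  rw [Nat.primesLE_eq_filter_range, Nat.primesLE_eq_filter_range, Nat.range_succ_eq_Icc_zero,
    Nat.range_succ_eq_Icc_zero, hunion, Finset.filter_union,
    Finset.sum_union (Finset.disjoint_filter_filter hdisj)]

/-- `G(A,t) ≤ ∑_{p ≤ A} 1/p`. [folklore] -/
theorem G_le_sum_inv (A t : ℝ) : G A t ≤ ∑ p ∈ Nat.primesLE ⌊A⌋₊, (p : ℝ)⁻¹ := by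
  unfold G
  refine Finset.sum_le_sum fun p hp => ?_
  have hp0 : (0 : ℝ) < p := by exact_mod_cast (Nat.mem_primesLE.mp hp).2.pos
  rw [div_eq_mul_inv]
  exact (mul_le_of_le_one_left (inv_nonneg.mpr hp0.le) (Real.cos_le_one _))

/-- `G(A,δ) ≥ ∑_{p ≤ A} 1/p - (δ²/2) log A (log A + 2)` for `A ≥ 1` (`cos u ≥ 1 - u²/2`,
`log p ≤ log A`, and Mertens' `∑_{p ≤ A} log p/p ≤ log A + 2`). [folklore] -/
theorem sum_inv_sub_le_G {A : ℝ} (hA : 1 ≤ A) (δ : ℝ) :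
    ∑ p ∈ Nat.primesLE ⌊A⌋₊, (p : ℝ)⁻¹ - δ ^ 2 / 2 * (Real.log A * (Real.log A + 2)) ≤ G A δ := by
  have hA0 : 0 < A := by linarith
  have hlA : 0 ≤ Real.log A := Real.log_nonneg hA
  have hM := (MertensBound.sum_log_div_prime_bounds hA).2
  -- termwise
  have hterm : ∀ p ∈ Nat.primesLE ⌊A⌋₊,
      (p : ℝ)⁻¹ - δ ^ 2 / 2 * (Real.log A * (Real.log p / p)) ≤ Real.cos (δ * Real.log p) / p := by
    intro p hp
    have hp' := Nat.mem_primesLE.mp hp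
    have hp0 : (0 : ℝ) < p := by exact_mod_cast hp'.2.pos
    have hp1 : (1 : ℝ) ≤ p := by exact_mod_cast hp'.2.one_lt.le
    have hpA : (p : ℝ) ≤ A := (Nat.cast_le.mpr hp'.1).trans (Nat.floor_le hA0.le)
    have hlp : 0 ≤ Real.log p := Real.log_nonneg hp1
    have hlpA : Real.log p ≤ Real.log A := Real.log_le_log hp0 hpA
    have hcos : 1 - (δ * Real.log p) ^ 2 / 2 ≤ Real.cos (δ * Real.log p) :=
      Real.one_sub_sq_div_two_le_cos
    have h1 : (p : ℝ)⁻¹ - δ ^ 2 / 2 * (Real.log A * (Real.log p / p))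
        ≤ (p : ℝ)⁻¹ - δ ^ 2 / 2 * (Real.log p * (Real.log p / p)) := by
      have : δ ^ 2 / 2 * (Real.log p * (Real.log p / p)) ≤ δ ^ 2 / 2 * (Real.log A * (Real.log p / p)) :=
        mul_le_mul_of_nonneg_left (mul_le_mul_of_nonneg_right hlpA (div_nonneg hlp hp0.le)) (by positivity)
      linarith
    refine h1.trans ?_
    rw [show (p : ℝ)⁻¹ - δ ^ 2 / 2 * (Real.log p * (Real.log p / p))
        = (1 - (δ * Real.log p) ^ 2 / 2) / p by field_simp]
    exact div_le_div_of_nonneg_right hcos hp0.le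
  calc ∑ p ∈ Nat.primesLE ⌊A⌋₊, (p : ℝ)⁻¹ - δ ^ 2 / 2 * (Real.log A * (Real.log A + 2))
      ≤ ∑ p ∈ Nat.primesLE ⌊A⌋₊, (p : ℝ)⁻¹
          - δ ^ 2 / 2 * (Real.log A * ∑ p ∈ Nat.primesLE ⌊A⌋₊, Real.log p / p) := by
        have : δ ^ 2 / 2 * (Real.log A * ∑ p ∈ Nat.primesLE ⌊A⌋₊, Real.log p / p)
            ≤ δ ^ 2 / 2 * (Real.log A * (Real.log A + 2)) :=
          mul_le_mul_of_nonneg_left (mul_le_mul_of_nonneg_left hM hlA) (by positivity)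
        linarith
    _ = ∑ p ∈ Nat.primesLE ⌊A⌋₊, ((p : ℝ)⁻¹ - δ ^ 2 / 2 * (Real.log A * (Real.log p / p))) := by
        rw [Finset.mul_sum, Finset.mul_sum, Finset.sum_sub_distrib]
    _ ≤ G A δ := Finset.sum_le_sum hterm

/-- **Lower bound for `G` at a small frequency**: there is an absolute `C` such that
`G(x,δ) ≥ log(1/δ) - C` whenever `0 < δ ≤ 1` and `x ≥ e^{1/δ}` (the primes `p ≤ e^{1/δ}` contribute
`≥ ∑_{p ≤ e^{1/δ}} (1 - δ² log² p/2)/p = log(1/δ) + O(1)`, the primes `e^{1/δ} < p ≤ x` contribute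
`∫_1^{δ log x} cos(s) ds/s + O(1) = O(1)`). [cite: GranvilleSoundararajan2003, proof of Lemma 2.3] -/
theorem exists_G_ge :
    ∃ C : ℝ, ∀ δ x : ℝ, 0 < δ → δ ≤ 1 → Real.exp (1 / δ) ≤ x → Real.log (1 / δ) - C ≤ G x δ := by
  obtain ⟨K₁, hK₁0, hPS⟩ := exists_abs_sum_prime_cos_sub_integral_le
  obtain ⟨K₂, hK₂⟩ := Mertens.abs_sum_primesLE_inv_sub_loglog_le 11
  refine ⟨|Mertens.meisselMertens| + |K₂| + 5 + 3 * K₁, fun δ x hδ hδ1 hx => ?_⟩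
  set A : ℝ := Real.exp (1 / δ) with hAdef
  have hlogA : Real.log A = 1 / δ := by rw [hAdef, Real.log_exp]
  have hδinv : 1 ≤ 1 / δ := by rw [le_div_iff₀ hδ]; linarith
  have hAe : Real.exp 1 ≤ A := Real.exp_le_exp.mpr hδinv
  have he : (2 : ℝ) < Real.exp 1 := by have := Real.exp_one_gt_d9; linarith
  have hA2 : 2 ≤ A := by linarith
  have hA1 : 1 ≤ A := by linarith
  -- head: `p ≤ A`
  have hhead : Real.log (1 / δ) + Mertens.meisselMertens - |K₂| - 3 / 2 ≤ G A δ := by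
    have h1 := sum_inv_sub_le_G hA1 δ
    have h2 := hK₂ A hA2
    rw [hlogA] at h2
    have h3 : Real.log (1 / δ) + Mertens.meisselMertens - K₂ / (1 / δ) ^ 11 ≤
        ∑ p ∈ Nat.primesLE ⌊A⌋₊, (p : ℝ)⁻¹ := by
      have := (abs_le.mp h2).1; linarith
    have h4 : K₂ / (1 / δ) ^ 11 ≤ |K₂| := by
      rw [div_le_iff₀ (by positivity)]
      calc K₂ ≤ |K₂| := le_abs_self _
        _ = |K₂| * 1 := (mul_one _).symm
        _ ≤ |K₂| * (1 / δ) ^ 11 := mul_le_mul_of_nonneg_left (one_le_pow₀ hδinv) (abs_nonneg _)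
    have h5 : δ ^ 2 / 2 * (Real.log A * (Real.log A + 2)) = 1 / 2 + δ := by
      rw [hlogA]; field_simp
    rw [h5] at h1
    linarith
  -- tail: `A < p ≤ x`
  have htail : |∑ p ∈ (Finset.Ioc ⌊A⌋₊ ⌊x⌋₊).filter Nat.Prime, Real.cos (δ * Real.log p) / p| ≤
      3 + 3 * K₁ := by
    have h1 := hPS δ A x hA2 hx
    have h2 := abs_integral_cos_log_div_le hδ.ne' (by linarith : (1 : ℝ) < A) hx
    rw [hlogA, abs_of_pos hδ] at h2
    have h3 : 3 / (δ * (1 / δ)) = 3 := by field_simp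
    rw [h3] at h2
    rw [hlogA, abs_of_pos hδ] at h1
    have h4 : 2 * K₁ / (1 / δ) ^ 11 ≤ 2 * K₁ := by
      rw [div_le_iff₀ (by positivity)]
      calc 2 * K₁ = 2 * K₁ * 1 := (mul_one _).symm
        _ ≤ 2 * K₁ * (1 / δ) ^ 11 := mul_le_mul_of_nonneg_left (one_le_pow₀ hδinv) (by positivity)
    have h5 : δ * K₁ / (10 * (1 / δ) ^ 10) ≤ K₁ := by
      rw [div_le_iff₀ (by positivity)]
      calc δ * K₁ ≤ 1 * K₁ := mul_le_mul_of_nonneg_right hδ1 hK₁0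
        _ = K₁ * 1 * 1 := by ring
        _ ≤ K₁ * 10 * (1 / δ) ^ 10 :=
            mul_le_mul (mul_le_mul_of_nonneg_left (by norm_num) hK₁0) (one_le_pow₀ hδinv) zero_le_one
              (by positivity)
        _ = K₁ * (10 * (1 / δ) ^ 10) := by ring
    calc |∑ p ∈ (Finset.Ioc ⌊A⌋₊ ⌊x⌋₊).filter Nat.Prime, Real.cos (δ * Real.log p) / p|
        ≤ |∑ p ∈ (Finset.Ioc ⌊A⌋₊ ⌊x⌋₊).filter Nat.Prime, Real.cos (δ * Real.log p) / p
            - ∫ v in A..x, Real.cos (δ * Real.log v) / (v * Real.log v)|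
          + |∫ v in A..x, Real.cos (δ * Real.log v) / (v * Real.log v)| := by
            have := abs_add_le (∑ p ∈ (Finset.Ioc ⌊A⌋₊ ⌊x⌋₊).filter Nat.Prime, Real.cos (δ * Real.log p) / p
              - ∫ v in A..x, Real.cos (δ * Real.log v) / (v * Real.log v))
              (∫ v in A..x, Real.cos (δ * Real.log v) / (v * Real.log v))
            rwa [sub_add_cancel] at this
      _ ≤ (2 * K₁ / (1 / δ) ^ 11 + δ * K₁ / (10 * (1 / δ) ^ 10)) + 3 := add_le_add h1 h2
      _ ≤ (2 * K₁ + K₁) + 3 := by gcongr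
      _ = 3 + 3 * K₁ := by ring
  rw [G_split hx δ]
  have := (abs_le.mp htail).1
  have hB : -|Mertens.meisselMertens| ≤ Mertens.meisselMertens := neg_abs_le _
  linarith

/-- **Upper bounds for `G`**: there is an absolute `C` such that, for all `x ≥ 2`,
`G(x,t) ≤ log(1/t) + C` for `0 < t ≤ 1`, and `G(x,t) ≤ (log t)/10 + C` for `t ≥ 1`
(the primes `p ≤ A` are estimated trivially by `∑_{p ≤ A} 1/p = log log A + O(1)` with `A = e^{1/t}`,
resp. `A = exp(t^{1/10})`, and the primes `A < p ≤ x` contribute `O(1)` by Abel summation with the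
remainder `O(1/log¹¹)` in Mertens' theorem). [cite: MontgomeryVaughan2007, §6.2] -/
theorem exists_G_le :
    ∃ C : ℝ, (∀ t x : ℝ, 0 < t → t ≤ 1 → 2 ≤ x → G x t ≤ Real.log (1 / t) + C) ∧
      (∀ t x : ℝ, 1 ≤ t → 2 ≤ x → G x t ≤ Real.log t / 10 + C) := by
  obtain ⟨K₁, hK₁0, hPS⟩ := exists_abs_sum_prime_cos_sub_integral_le
  obtain ⟨K₂, hK₂⟩ := Mertens.abs_sum_primesLE_inv_sub_loglog_le 11
  have hl2 : 0 < Real.log 2 := Real.log_pos one_lt_two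
  have hl2' : Real.log 2 ≤ 1 := by have := Real.log_two_lt_d9; linarith
  set K₂' : ℝ := |K₂| / Real.log 2 ^ 11 with hK₂'
  have hK₂'0 : 0 ≤ K₂' := by positivity
  -- Mertens upper bound with a uniform constant
  have hMert : ∀ v : ℝ, 2 ≤ v → ∑ p ∈ Nat.primesLE ⌊v⌋₊, (p : ℝ)⁻¹ ≤
      Real.log (Real.log v) + Mertens.meisselMertens + K₂' := by
    intro v hv
    have h := (abs_le.mp (hK₂ v hv)).2
    have hlv : Real.log 2 ≤ Real.log v := Real.log_le_log two_pos hv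
    have hlv0 : 0 < Real.log v := hl2.trans_le hlv
    have hK : K₂ / Real.log v ^ 11 ≤ K₂' := by
      calc K₂ / Real.log v ^ 11 ≤ |K₂| / Real.log v ^ 11 :=
            div_le_div_of_nonneg_right (le_abs_self _) (by positivity)
        _ ≤ |K₂| / Real.log 2 ^ 11 :=
            div_le_div_of_nonneg_left (abs_nonneg _) (by positivity) (pow_le_pow_left₀ hl2.le hlv 11)
    linarith
  -- the tail bound, for `log A ≥ 1` and `|t| ≤ log¹⁰ A`... packaged as: `2 ≤ A`, `1 ≤ |t| log A`,
  -- `|t| ≤ 10 (log A)^10`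
  have htail : ∀ t A x : ℝ, t ≠ 0 → 2 ≤ A → A ≤ x → 1 ≤ Real.log A → 1 ≤ |t| * Real.log A →
      |t| ≤ 10 * Real.log A ^ 10 →
      |∑ p ∈ (Finset.Ioc ⌊A⌋₊ ⌊x⌋₊).filter Nat.Prime, Real.cos (t * Real.log p) / p| ≤ 3 + 3 * K₁ := by
    intro t A x ht hA hAx hlA htl htu
    have hA1 : (1 : ℝ) < A := by linarith
    have h1 := hPS t A x hA hAx
    have h2 := abs_integral_cos_log_div_le ht hA1 hAx
    have ht0 : 0 < |t| := abs_pos.mpr ht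
    have h3 : 3 / (|t| * Real.log A) ≤ 3 := by
      rw [div_le_iff₀ (by positivity)]; linarith
    have h4 : 2 * K₁ / Real.log A ^ 11 ≤ 2 * K₁ := by
      rw [div_le_iff₀ (by positivity)]
      calc 2 * K₁ = 2 * K₁ * 1 := (mul_one _).symm
        _ ≤ 2 * K₁ * Real.log A ^ 11 := mul_le_mul_of_nonneg_left (one_le_pow₀ hlA) (by positivity)
    have h5 : |t| * K₁ / (10 * Real.log A ^ 10) ≤ K₁ := by
      rw [div_le_iff₀ (by positivity)]
      calc |t| * K₁ ≤ (10 * Real.log A ^ 10) * K₁ := mul_le_mul_of_nonneg_right htu hK₁0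
        _ = K₁ * (10 * Real.log A ^ 10) := by ring
    calc |∑ p ∈ (Finset.Ioc ⌊A⌋₊ ⌊x⌋₊).filter Nat.Prime, Real.cos (t * Real.log p) / p|
        ≤ |∑ p ∈ (Finset.Ioc ⌊A⌋₊ ⌊x⌋₊).filter Nat.Prime, Real.cos (t * Real.log p) / p
            - ∫ v in A..x, Real.cos (t * Real.log v) / (v * Real.log v)|
          + |∫ v in A..x, Real.cos (t * Real.log v) / (v * Real.log v)| := by
            have := abs_add_le (∑ p ∈ (Finset.Ioc ⌊A⌋₊ ⌊x⌋₊).filter Nat.Prime, Real.cos (t * Real.log p) / p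
              - ∫ v in A..x, Real.cos (t * Real.log v) / (v * Real.log v))
              (∫ v in A..x, Real.cos (t * Real.log v) / (v * Real.log v))
            rwa [sub_add_cancel] at this
      _ ≤ (2 * K₁ / Real.log A ^ 11 + |t| * K₁ / (10 * Real.log A ^ 10)) + 3 / (|t| * Real.log A) :=
          add_le_add h1 h2
      _ ≤ (2 * K₁ + K₁) + 3 := by gcongr
      _ = 3 + 3 * K₁ := by ring
  refine ⟨|Mertens.meisselMertens| + K₂' + 3 + 3 * K₁, ?_, ?_⟩
  · -- small `t`
    intro t x ht ht1 hx
    have hB : Mertens.meisselMertens ≤ |Mertens.meisselMertens| := le_abs_self _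
    set A : ℝ := Real.exp (1 / t) with hAdef
    have hlogA : Real.log A = 1 / t := by rw [hAdef, Real.log_exp]
    have htinv : 1 ≤ 1 / t := by rw [le_div_iff₀ ht]; linarith
    have hlx : 0 < Real.log x := Real.log_pos (by linarith)
    rcases le_or_gt x A with hxA | hxA
    · -- only the head
      have h1 := G_le_sum_inv x t
      have h2 := hMert x hx
      have h3 : Real.log (Real.log x) ≤ Real.log (1 / t) := by
        rw [← hlogA]; exact Real.log_le_log hlx (Real.log_le_log (by linarith) hxA)
      linarith [hK₁0]
    · have hAe : Real.exp 1 ≤ A := Real.exp_le_exp.mpr htinv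
      have he : (2 : ℝ) < Real.exp 1 := by have := Real.exp_one_gt_d9; linarith
      have hA2 : 2 ≤ A := by linarith
      rw [G_split hxA.le t]
      have h1 := G_le_sum_inv A t
      have h2 := hMert A hA2
      rw [hlogA] at h2
      have h3 := htail t A x ht.ne' hA2 hxA.le (by rw [hlogA]; exact htinv)
        (by rw [hlogA, abs_of_pos ht]; field_simp; rfl)
        (by
          rw [hlogA, abs_of_pos ht]
          calc t ≤ 1 := ht1
            _ ≤ 10 * 1 := by norm_num
            _ ≤ 10 * (1 / t) ^ 10 := by gcongr; exact one_le_pow₀ htinv)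
      have h4 := (abs_le.mp h3).2
      linarith
  · -- large `t`
    intro t x ht hx
    have hB : Mertens.meisselMertens ≤ |Mertens.meisselMertens| := le_abs_self _
    have ht0 : 0 < t := by linarith
    set A : ℝ := Real.exp (t ^ (1 / 10 : ℝ)) with hAdef
    have hroot1 : 1 ≤ t ^ (1 / 10 : ℝ) := Real.one_le_rpow ht (by norm_num)
    have hlogA : Real.log A = t ^ (1 / 10 : ℝ) := by rw [hAdef, Real.log_exp]
    have hloglogA : Real.log (Real.log A) = Real.log t / 10 := by
      rw [hlogA, Real.log_rpow ht0]; ring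
    have hlx : 0 < Real.log x := Real.log_pos (by linarith)
    have hpow10 : Real.log A ^ 10 = t := by
      rw [hlogA, ← Real.rpow_natCast, ← Real.rpow_mul ht0.le]; norm_num
    rcases le_or_gt x A with hxA | hxA
    · have h1 := G_le_sum_inv x t
      have h2 := hMert x hx
      have h3 : Real.log (Real.log x) ≤ Real.log t / 10 := by
        rw [← hloglogA]
        exact Real.log_le_log hlx (Real.log_le_log (by linarith) hxA)
      linarith [hK₁0]
    · have hAe : Real.exp 1 ≤ A := Real.exp_le_exp.mpr hroot1
      have he : (2 : ℝ) < Real.exp 1 := by have := Real.exp_one_gt_d9; linarith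
      have hA2 : 2 ≤ A := by linarith
      rw [G_split hxA.le t]
      have h1 := G_le_sum_inv A t
      have h2 := hMert A hA2
      rw [hloglogA] at h2
      have h3 := htail t A x ht0.ne' hA2 hxA.le (by rw [hlogA]; exact hroot1)
        (by
          rw [abs_of_pos ht0, hlogA]
          calc (1 : ℝ) = 1 * 1 := by norm_num
            _ ≤ t * t ^ (1 / 10 : ℝ) := mul_le_mul ht hroot1 zero_le_one ht0.le)
        (by rw [abs_of_pos ht0, hpow10]; linarith)
      have h4 := (abs_le.mp h3).2
      linarith

end Literature.NumberTheory.LFunctions.PrimeCosineSum
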